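import Mathlib.Analysis.Calculus.ContDiff.Bounds
import Mathlib.Analysis.Calculus.IteratedDeriv.Lemmas
import Mathlib.Analysis.Calculus.Deriv.ZPow
import Mathlib.Analysis.SpecialFunctions.SmoothTransition
import HarnessLib

/-!
# Tame functions: smooth functions with polynomially weighted bounds on the first derivatives

Analysis/Calculus support file (everything proved).  On an open subset `U` of a real normed space
`X` carrying a weight `B : X → ℝ` with `1 ≤ B` on `U`, call a function `f : X → F` *tame* when it
is `C^∞` on `U` and its derivatives of order `i ≤ 2` within `U` satisfy
`‖iteratedFDerivWithin ℝ i f U x‖ ≤ C · B x ^ k` on `U` for some `C, k`.  NO definition is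
introduced: every statement spells the property out as the conjunction
`ContDiffOn ℝ ∞ f U ∧ ∃ C k, ∀ x ∈ U, ∀ i ≤ 2, ‖iteratedFDerivWithin ℝ i f U x‖ ≤ C * B x ^ k`,
so that the lemmas compose by `exact`.  This is the bookkeeping behind cut-off functions with
polynomially controlled `C²` norms on cones and Siegel sets (Borel's partitions of unity in
reduction theory; `Literature/NumberTheory/Automorphic/SiegelReducedFamiliesCutoff.lean`), where
the weight is `1 + ∑ (‖H_ij‖ + ‖(H⁻¹)_ij‖)`.

Tame functions are stable under: change of the function off `U` (`tame_congr`), constants,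
continuous linear maps for a weight dominating the norm (`tame_clm`), post-composition with
continuous linear maps, sums, differences, products (Leibniz bound
`norm_iteratedFDerivWithin_mul_le`), finite products, composition with a smooth function of one
variable whose derivatives along the range are polynomially bounded (Faà di Bruno bound
`norm_iteratedFDerivWithin_comp_le`, `tame_comp`) — in particular with `Real.smoothTransition`,
whose derivatives of order `≤ 2` are uniformly bounded
(`exists_bound_iteratedFDeriv_two_smoothTransition`: it is locally constant off the compact
`[0, 1]`), and with `t ↦ 1/t` for positive functions with polynomially bounded inverse (`tame_inv`,
`iter_deriv_inv`).  Finally `tame_apply_bounds` turns the bounds into the applied form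
`‖fderiv ℝ f x v‖ ≤ C B^k ‖v‖`, `‖iteratedFDeriv ℝ 2 f x ![v, w]‖ ≤ C B^k ‖v‖ ‖w‖` at points of the
open set.

## Mathlib / tree search

Mathlib: `Function.HasTemperateGrowth` is the global notion with weight `1 + ‖x‖` (whole space,
all orders); nothing relative to an open set and an arbitrary weight.  Tree:
`exists_bound_iteratedFDeriv_smoothTransition` in
`Literature.NumberTheory.Sieve.FriedlanderIwaniecPrimes` (all orders, heavier imports) — the
order-two case is re-proved here to keep the imports minimal.

## References

* L. Hörmander, *The Analysis of Linear Partial Differential Operators I*, 2nd ed. (1990), §1.4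
  (cut-off functions and their derivative bounds); the material is folklore.
-/

noncomputable section

open Set
open scoped Topology ContDiff

namespace Literature.Analysis.Calculus

variable {X : Type*} [NormedAddCommGroup X] [NormedSpace ℝ X]
  {F : Type*} [NormedAddCommGroup F] [NormedSpace ℝ F]
  {F' : Type*} [NormedAddCommGroup F'] [NormedSpace ℝ F']
  {𝔸 : Type*} [NormedRing 𝔸] [NormedAlgebra ℝ 𝔸]
  {𝔸' : Type*} [NormedCommRing 𝔸'] [NormedAlgebra ℝ 𝔸']
  {U : Set X} {B : X → ℝ}

/-- Weakening a polynomial bound: replace the constant by its absolute value and enlarge the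
exponent. [folklore] -/
theorem tame_weaken {b : ℝ} (hB1 : 1 ≤ b) {a C : ℝ} {k k' : ℕ} (hk : k ≤ k')
    (ha : a ≤ C * b ^ k) : a ≤ |C| * b ^ k' :=
  ha.trans ((mul_le_mul_of_nonneg_right (le_abs_self C)
    (pow_nonneg (zero_le_one.trans hB1) k)).trans
    (mul_le_mul_of_nonneg_left (pow_le_pow_right₀ hB1 hk) (abs_nonneg C)))

/-- Tameness only depends on the values on `U`. [folklore] -/
theorem tame_congr (hU : IsOpen U) {f g : X → F} (hfg : EqOn f g U)
    (hf : ContDiffOn ℝ ∞ f U ∧ ∃ (C : ℝ) (k : ℕ), ∀ x ∈ U, ∀ i ≤ 2,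
      ‖iteratedFDerivWithin ℝ i f U x‖ ≤ C * B x ^ k) :
    ContDiffOn ℝ ∞ g U ∧ ∃ (C : ℝ) (k : ℕ), ∀ x ∈ U, ∀ i ≤ 2,
      ‖iteratedFDerivWithin ℝ i g U x‖ ≤ C * B x ^ k := by
  have _hU := hU
  obtain ⟨hf, C, k, hb⟩ := hf
  refine ⟨hf.congr fun x hx => (hfg hx).symm, C, k, fun x hx i hi => ?_⟩
  rw [← iteratedFDerivWithin_congr hfg hx i]
  exact hb x hx i hi

/-- Constants are tame. [folklore] -/
theorem tame_const (hB : ∀ x ∈ U, 1 ≤ B x) (a : F) :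
    ContDiffOn ℝ ∞ (fun _ : X => a) U ∧ ∃ (C : ℝ) (k : ℕ), ∀ x ∈ U, ∀ i ≤ 2,
      ‖iteratedFDerivWithin ℝ i (fun _ : X => a) U x‖ ≤ C * B x ^ k := by
  refine ⟨contDiffOn_const, ‖a‖, 0, fun x hx i _ => ?_⟩
  have _h := hB x hx
  rw [pow_zero, mul_one]
  rcases Nat.eq_zero_or_pos i with rfl | hi0
  · rw [norm_iteratedFDerivWithin_zero]
  · rw [iteratedFDerivWithin_const_of_ne hi0.ne', Pi.zero_apply, norm_zero]
    exact norm_nonneg _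

/-- Continuous linear maps are tame (for a weight dominating the norm). [folklore] -/
theorem tame_clm (hU : IsOpen U) (hB : ∀ x ∈ U, 1 ≤ B x) (hBn : ∀ x ∈ U, ‖x‖ ≤ B x)
    (L : X →L[ℝ] F) :
    ContDiffOn ℝ ∞ (fun x => L x) U ∧ ∃ (C : ℝ) (k : ℕ), ∀ x ∈ U, ∀ i ≤ 2,
      ‖iteratedFDerivWithin ℝ i (fun x => L x) U x‖ ≤ C * B x ^ k := by
  refine ⟨L.contDiff.contDiffOn, ‖L‖, 1, fun x hx i hi => ?_⟩
  rw [iteratedFDerivWithin_of_isOpen i hU hx, pow_one]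
  have h0 : 0 ≤ ‖L‖ := norm_nonneg L
  rcases Nat.lt_or_ge i 1 with h | h
  · obtain rfl : i = 0 := by omega
    rw [norm_iteratedFDeriv_zero]
    exact (L.le_opNorm x).trans (mul_le_mul_of_nonneg_left (hBn x hx) h0)
  rcases Nat.lt_or_ge i 2 with h' | h'
  · obtain rfl : i = 1 := by omega
    rw [norm_iteratedFDeriv_one, show (fun x => L x) = ⇑L from rfl, L.fderiv]
    exact le_mul_of_one_le_right h0 (hB x hx)
  · obtain rfl : i = 2 := by omega
    rw [show (fun x => L x) = ⇑L from rfl,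
      show ‖iteratedFDeriv ℝ 2 (⇑L) x‖ = ‖iteratedFDeriv ℝ (1 + 1) (⇑L) x‖ from rfl,
      ← norm_iteratedFDeriv_fderiv]
    have hf : fderiv ℝ (⇑L) = fun _ => L := funext fun y => L.fderiv
    rw [hf, iteratedFDeriv_const_of_ne one_ne_zero, Pi.zero_apply, norm_zero]
    exact mul_nonneg h0 (zero_le_one.trans (hB x hx))

/-- Post-composition with a continuous linear map preserves tameness. [folklore] -/
theorem tame_clm_comp (hU : IsOpen U) (L : F →L[ℝ] F') {f : X → F}
    (hf : ContDiffOn ℝ ∞ f U ∧ ∃ (C : ℝ) (k : ℕ), ∀ x ∈ U, ∀ i ≤ 2,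
      ‖iteratedFDerivWithin ℝ i f U x‖ ≤ C * B x ^ k) :
    ContDiffOn ℝ ∞ (fun x => L (f x)) U ∧ ∃ (C : ℝ) (k : ℕ), ∀ x ∈ U, ∀ i ≤ 2,
      ‖iteratedFDerivWithin ℝ i (fun x => L (f x)) U x‖ ≤ C * B x ^ k := by
  obtain ⟨hf, C, k, hb⟩ := hf
  refine ⟨L.contDiff.comp_contDiffOn hf, ‖L‖ * C, k, fun x hx i hi => ?_⟩
  calc ‖iteratedFDerivWithin ℝ i (fun x => L (f x)) U x‖
      = ‖iteratedFDerivWithin ℝ i (L ∘ f) U x‖ := rfl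
    _ ≤ ‖L‖ * ‖iteratedFDerivWithin ℝ i f U x‖ :=
        L.norm_iteratedFDerivWithin_comp_left (hf x hx) hU.uniqueDiffOn hx (mod_cast le_top)
    _ ≤ ‖L‖ * (C * B x ^ k) := mul_le_mul_of_nonneg_left (hb x hx i hi) (norm_nonneg L)
    _ = ‖L‖ * C * B x ^ k := by ring

/-- Sums of tame functions are tame. [folklore] -/
theorem tame_add (hU : IsOpen U) (hB : ∀ x ∈ U, 1 ≤ B x) {f g : X → F}
    (hf : ContDiffOn ℝ ∞ f U ∧ ∃ (C : ℝ) (k : ℕ), ∀ x ∈ U, ∀ i ≤ 2,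
      ‖iteratedFDerivWithin ℝ i f U x‖ ≤ C * B x ^ k)
    (hg : ContDiffOn ℝ ∞ g U ∧ ∃ (C : ℝ) (k : ℕ), ∀ x ∈ U, ∀ i ≤ 2,
      ‖iteratedFDerivWithin ℝ i g U x‖ ≤ C * B x ^ k) :
    ContDiffOn ℝ ∞ (fun x => f x + g x) U ∧ ∃ (C : ℝ) (k : ℕ), ∀ x ∈ U, ∀ i ≤ 2,
      ‖iteratedFDerivWithin ℝ i (fun x => f x + g x) U x‖ ≤ C * B x ^ k := by
  obtain ⟨hf, Cf, kf, hbf⟩ := hf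
  obtain ⟨hg, Cg, kg, hbg⟩ := hg
  refine ⟨hf.add hg, |Cf| + |Cg|, max kf kg, fun x hx i hi => ?_⟩
  have hi' : (i : ℕ∞ω) ≤ ∞ := mod_cast le_top
  rw [show (fun x => f x + g x) = f + g from rfl,
    iteratedFDerivWithin_add_apply ((hf x hx).of_le hi') ((hg x hx).of_le hi') hU.uniqueDiffOn hx]
  calc ‖iteratedFDerivWithin ℝ i f U x + iteratedFDerivWithin ℝ i g U x‖
      ≤ ‖iteratedFDerivWithin ℝ i f U x‖ + ‖iteratedFDerivWithin ℝ i g U x‖ := norm_add_le _ _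
    _ ≤ |Cf| * B x ^ max kf kg + |Cg| * B x ^ max kf kg :=
        add_le_add (tame_weaken (hB x hx) (le_max_left _ _) (hbf x hx i hi))
          (tame_weaken (hB x hx) (le_max_right _ _) (hbg x hx i hi))
    _ = (|Cf| + |Cg|) * B x ^ max kf kg := by ring

/-- Differences of tame functions are tame. [folklore] -/
theorem tame_sub (hU : IsOpen U) (hB : ∀ x ∈ U, 1 ≤ B x) {f g : X → F}
    (hf : ContDiffOn ℝ ∞ f U ∧ ∃ (C : ℝ) (k : ℕ), ∀ x ∈ U, ∀ i ≤ 2,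
      ‖iteratedFDerivWithin ℝ i f U x‖ ≤ C * B x ^ k)
    (hg : ContDiffOn ℝ ∞ g U ∧ ∃ (C : ℝ) (k : ℕ), ∀ x ∈ U, ∀ i ≤ 2,
      ‖iteratedFDerivWithin ℝ i g U x‖ ≤ C * B x ^ k) :
    ContDiffOn ℝ ∞ (fun x => f x - g x) U ∧ ∃ (C : ℝ) (k : ℕ), ∀ x ∈ U, ∀ i ≤ 2,
      ‖iteratedFDerivWithin ℝ i (fun x => f x - g x) U x‖ ≤ C * B x ^ k := by
  obtain ⟨hf, Cf, kf, hbf⟩ := hf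
  obtain ⟨hg, Cg, kg, hbg⟩ := hg
  refine ⟨hf.sub hg, |Cf| + |Cg|, max kf kg, fun x hx i hi => ?_⟩
  have hi' : (i : ℕ∞ω) ≤ ∞ := mod_cast le_top
  rw [show (fun x => f x - g x) = f - g from rfl,
    iteratedFDerivWithin_sub_apply ((hf x hx).of_le hi') ((hg x hx).of_le hi') hU.uniqueDiffOn hx]
  calc ‖iteratedFDerivWithin ℝ i f U x - iteratedFDerivWithin ℝ i g U x‖
      ≤ ‖iteratedFDerivWithin ℝ i f U x‖ + ‖iteratedFDerivWithin ℝ i g U x‖ := norm_sub_le _ _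
    _ ≤ |Cf| * B x ^ max kf kg + |Cg| * B x ^ max kf kg :=
        add_le_add (tame_weaken (hB x hx) (le_max_left _ _) (hbf x hx i hi))
          (tame_weaken (hB x hx) (le_max_right _ _) (hbg x hx i hi))
    _ = (|Cf| + |Cg|) * B x ^ max kf kg := by ring

/-- Products of tame functions (valued in a normed algebra) are tame: Leibniz bound
`norm_iteratedFDerivWithin_mul_le`. [folklore] -/
theorem tame_mul (hU : IsOpen U) (hB : ∀ x ∈ U, 1 ≤ B x) {f g : X → 𝔸}
    (hf : ContDiffOn ℝ ∞ f U ∧ ∃ (C : ℝ) (k : ℕ), ∀ x ∈ U, ∀ i ≤ 2,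
      ‖iteratedFDerivWithin ℝ i f U x‖ ≤ C * B x ^ k)
    (hg : ContDiffOn ℝ ∞ g U ∧ ∃ (C : ℝ) (k : ℕ), ∀ x ∈ U, ∀ i ≤ 2,
      ‖iteratedFDerivWithin ℝ i g U x‖ ≤ C * B x ^ k) :
    ContDiffOn ℝ ∞ (fun x => f x * g x) U ∧ ∃ (C : ℝ) (k : ℕ), ∀ x ∈ U, ∀ i ≤ 2,
      ‖iteratedFDerivWithin ℝ i (fun x => f x * g x) U x‖ ≤ C * B x ^ k := by
  obtain ⟨hf, Cf, kf, hbf⟩ := hf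
  obtain ⟨hg, Cg, kg, hbg⟩ := hg
  refine ⟨hf.mul hg, 4 * (|Cf| * |Cg|), kf + kg, fun x hx i hi => ?_⟩
  have hB0 : 0 ≤ B x := zero_le_one.trans (hB x hx)
  have h1 := norm_iteratedFDerivWithin_mul_le hf hg hU.uniqueDiffOn hx (n := i) (mod_cast le_top)
  refine h1.trans ?_
  calc ∑ j ∈ Finset.range (i + 1), (i.choose j : ℝ) * ‖iteratedFDerivWithin ℝ j f U x‖ *
        ‖iteratedFDerivWithin ℝ (i - j) g U x‖
      ≤ ∑ j ∈ Finset.range (i + 1), (i.choose j : ℝ) * (|Cf| * B x ^ kf) * (|Cg| * B x ^ kg) := by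
        refine Finset.sum_le_sum fun j hj => ?_
        have hj' : j ≤ 2 := by
          have := Finset.mem_range.mp hj
          omega
        refine mul_le_mul (mul_le_mul_of_nonneg_left
          (tame_weaken (hB x hx) le_rfl (hbf x hx j hj')) (Nat.cast_nonneg _))
          (tame_weaken (hB x hx) le_rfl (hbg x hx (i - j) (by omega))) (norm_nonneg _)
          (mul_nonneg (Nat.cast_nonneg _) (mul_nonneg (abs_nonneg _) (pow_nonneg hB0 _)))
    _ = (∑ j ∈ Finset.range (i + 1), (i.choose j : ℝ)) * (|Cf| * |Cg|) * B x ^ (kf + kg) := by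
        rw [Finset.sum_mul, Finset.sum_mul, pow_add]
        refine Finset.sum_congr rfl fun j _ => ?_
        ring
    _ ≤ 4 * (|Cf| * |Cg|) * B x ^ (kf + kg) := by
        refine mul_le_mul_of_nonneg_right (mul_le_mul_of_nonneg_right ?_
          (mul_nonneg (abs_nonneg _) (abs_nonneg _))) (pow_nonneg hB0 _)
        have h2 : (∑ j ∈ Finset.range (i + 1), (i.choose j : ℝ)) = 2 ^ i := by
          rw [← Nat.cast_sum, Nat.sum_range_choose]
          simp
        rw [h2]
        calc (2 : ℝ) ^ i ≤ 2 ^ 2 := pow_le_pow_right₀ one_le_two hi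
          _ = 4 := by norm_num

/-- Finite products of tame functions (valued in a commutative normed algebra) are tame.
[folklore] -/
theorem tame_finset_prod (hU : IsOpen U) (hB : ∀ x ∈ U, 1 ≤ B x) [NormOneClass 𝔸']
    {κ : Type*} (s : Finset κ) {f : κ → X → 𝔸'}
    (hf : ∀ a ∈ s, ContDiffOn ℝ ∞ (f a) U ∧ ∃ (C : ℝ) (k : ℕ), ∀ x ∈ U, ∀ i ≤ 2,
      ‖iteratedFDerivWithin ℝ i (f a) U x‖ ≤ C * B x ^ k) :
    ContDiffOn ℝ ∞ (fun x => ∏ a ∈ s, f a x) U ∧ ∃ (C : ℝ) (k : ℕ), ∀ x ∈ U, ∀ i ≤ 2,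
      ‖iteratedFDerivWithin ℝ i (fun x => ∏ a ∈ s, f a x) U x‖ ≤ C * B x ^ k := by
  classical
  induction s using Finset.induction_on with
  | empty =>
    simp only [Finset.prod_empty]
    exact tame_const hB 1
  | insert b s hb ih =>
    have h := tame_mul hU hB (hf b (Finset.mem_insert_self b s))
      (ih fun a ha => hf a (Finset.mem_insert_of_mem ha))
    simp only [Finset.prod_insert hb]
    exact h

/-- Composition of a real-valued tame function with a smooth function of one variable whose
derivatives of order `≤ 2` along the range are polynomially bounded is tame (Faà di Bruno bound
`norm_iteratedFDerivWithin_comp_le`). [folklore] -/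
theorem tame_comp (hU : IsOpen U) (hB : ∀ x ∈ U, 1 ≤ B x) {t : Set ℝ} (ht : IsOpen t)
    {g : ℝ → F} (hg : ContDiffOn ℝ ∞ g t) {f : X → ℝ} (hft : MapsTo f U t)
    {Cg : ℝ} {kg : ℕ}
    (hgb : ∀ x ∈ U, ∀ i ≤ 2, ‖iteratedFDerivWithin ℝ i g t (f x)‖ ≤ Cg * B x ^ kg)
    (hf : ContDiffOn ℝ ∞ f U ∧ ∃ (C : ℝ) (k : ℕ), ∀ x ∈ U, ∀ i ≤ 2,
      ‖iteratedFDerivWithin ℝ i f U x‖ ≤ C * B x ^ k) :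
    ContDiffOn ℝ ∞ (fun x => g (f x)) U ∧ ∃ (C : ℝ) (k : ℕ), ∀ x ∈ U, ∀ i ≤ 2,
      ‖iteratedFDerivWithin ℝ i (fun x => g (f x)) U x‖ ≤ C * B x ^ k := by
  obtain ⟨hf, Cf, kf, hbf⟩ := hf
  refine ⟨hg.comp hf hft, 2 * |Cg| * (1 + |Cf|) ^ 2, kg + 2 * kf, fun x hx i hi => ?_⟩
  have hB1 := hB x hx
  have hB0 : 0 ≤ B x := zero_le_one.trans hB1
  set D : ℝ := (1 + |Cf|) * B x ^ kf with hD_def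
  have hD1 : 1 ≤ D := by
    have : (1 : ℝ) ≤ 1 + |Cf| := le_add_of_nonneg_right (abs_nonneg _)
    nlinarith [one_le_pow₀ (M₀ := ℝ) hB1 (n := kf)]
  have hD : ∀ j, 1 ≤ j → j ≤ i → ‖iteratedFDerivWithin ℝ j f U x‖ ≤ D ^ j := by
    intro j hj1 hji
    have h1 : ‖iteratedFDerivWithin ℝ j f U x‖ ≤ D := by
      refine (tame_weaken hB1 le_rfl (hbf x hx j (hji.trans hi))).trans ?_
      rw [hD_def]
      exact mul_le_mul_of_nonneg_right (by linarith [abs_nonneg Cf]) (pow_nonneg hB0 _)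
    exact h1.trans (le_self_pow₀ hD1 (by omega))
  have hC : ∀ j, j ≤ i → ‖iteratedFDerivWithin ℝ j g t (f x)‖ ≤ |Cg| * B x ^ kg :=
    fun j hji => tame_weaken hB1 le_rfl (hgb x hx j (hji.trans hi))
  have h := norm_iteratedFDerivWithin_comp_le hg hf (mod_cast le_top) ht.uniqueDiffOn
    hU.uniqueDiffOn hft hx hC hD
  rw [show (fun x => g (f x)) = g ∘ f from rfl]
  refine h.trans ?_
  have hfact : (i.factorial : ℝ) ≤ 2 := by
    have h2 : i.factorial ≤ 2 := by
      rcases (by omega : i = 0 ∨ i = 1 ∨ i = 2) with rfl | rfl | rfl <;> decide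
    exact_mod_cast h2
  have hDi : D ^ i ≤ D ^ 2 := pow_le_pow_right₀ hD1 hi
  calc (i.factorial : ℝ) * (|Cg| * B x ^ kg) * D ^ i
      ≤ 2 * (|Cg| * B x ^ kg) * D ^ 2 := by
        refine mul_le_mul (mul_le_mul_of_nonneg_right hfact
          (mul_nonneg (abs_nonneg _) (pow_nonneg hB0 _))) hDi (pow_nonneg (zero_le_one.trans hD1) _)
          (mul_nonneg zero_le_two (mul_nonneg (abs_nonneg _) (pow_nonneg hB0 _)))
    _ = 2 * |Cg| * (1 + |Cf|) ^ 2 * B x ^ (kg + 2 * kf) := by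
        rw [hD_def]; ring

/-- The inverse of a positive tame function whose inverse is polynomially bounded is tame.
[folklore] -/
theorem tame_inv (hU : IsOpen U) (hB : ∀ x ∈ U, 1 ≤ B x) {f : X → ℝ}
    (hpos : ∀ x ∈ U, 0 < f x) {Ci : ℝ} {ki : ℕ} (hib : ∀ x ∈ U, (f x)⁻¹ ≤ Ci * B x ^ ki)
    (hf : ContDiffOn ℝ ∞ f U ∧ ∃ (C : ℝ) (k : ℕ), ∀ x ∈ U, ∀ i ≤ 2,
      ‖iteratedFDerivWithin ℝ i f U x‖ ≤ C * B x ^ k) :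
    ContDiffOn ℝ ∞ (fun x => (f x)⁻¹) U ∧ ∃ (C : ℝ) (k : ℕ), ∀ x ∈ U, ∀ i ≤ 2,
      ‖iteratedFDerivWithin ℝ i (fun x => (f x)⁻¹) U x‖ ≤ C * B x ^ k := by
  have hmaps : MapsTo f U (Ioi 0) := fun x hx => hpos x hx
  have hg : ContDiffOn ℝ ∞ (Inv.inv : ℝ → ℝ) (Ioi 0) :=
    (contDiffOn_inv (𝕜 := ℝ) (𝕜' := ℝ)).mono fun y hy => ne_of_gt (mem_Ioi.mp hy)
  refine tame_comp hU hB isOpen_Ioi hg hmaps (Cg := 2 * (1 + |Ci|) ^ 3) (kg := 3 * ki) ?_ hf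
  intro x hx i hi
  have hB1 := hB x hx
  have hB0 : 0 ≤ B x := zero_le_one.trans hB1
  have hfx := hpos x hx
  rw [norm_iteratedFDerivWithin_eq_norm_iteratedDerivWithin,
    iteratedDerivWithin_of_isOpen_eq_iterate isOpen_Ioi (hmaps hx), iter_deriv_inv,
    show (-1 - (i : ℤ)) = -((i + 1 : ℕ) : ℤ) by push_cast; ring, zpow_neg, zpow_natCast]
  simp only [norm_mul, norm_pow, norm_neg, norm_one, one_pow, one_mul, norm_inv,
    Real.norm_eq_abs, abs_of_pos hfx, Nat.abs_cast]
  rw [← inv_pow]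
  -- goal: i! * (f x)⁻¹ ^ (i + 1) ≤ 2 * (1 + |Ci|) ^ 3 * B x ^ (3 * ki)
  set E : ℝ := (1 + |Ci|) * B x ^ ki with hE_def
  have hE1 : 1 ≤ E := by
    have : (1 : ℝ) ≤ 1 + |Ci| := le_add_of_nonneg_right (abs_nonneg _)
    nlinarith [one_le_pow₀ (M₀ := ℝ) hB1 (n := ki)]
  have hfE : (f x)⁻¹ ≤ E := by
    refine (tame_weaken hB1 le_rfl (hib x hx)).trans ?_
    rw [hE_def]
    exact mul_le_mul_of_nonneg_right (by linarith [abs_nonneg Ci]) (pow_nonneg hB0 _)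
  have hfact : (i.factorial : ℝ) ≤ 2 := by
    have h2 : i.factorial ≤ 2 := by
      rcases (by omega : i = 0 ∨ i = 1 ∨ i = 2) with rfl | rfl | rfl <;> decide
    exact_mod_cast h2
  have hpow : (f x)⁻¹ ^ (i + 1) ≤ E ^ 3 :=
    (pow_le_pow_left₀ (inv_pos.mpr hfx).le hfE _).trans (pow_le_pow_right₀ hE1 (by omega))
  calc (i.factorial : ℝ) * (f x)⁻¹ ^ (i + 1) ≤ 2 * E ^ 3 :=
        mul_le_mul hfact hpow (pow_nonneg (inv_pos.mpr hfx).le _) zero_le_two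
    _ = 2 * (1 + |Ci|) ^ 3 * B x ^ (3 * ki) := by rw [hE_def]; ring

/-- **Uniform bounds for the derivatives of order `≤ 2` of `Real.smoothTransition`** (it is
smooth and locally constant off the compact interval `[0, 1]`). [folklore] -/
theorem exists_bound_iteratedFDeriv_two_smoothTransition :
    ∃ Cρ : ℝ, ∀ i ≤ 2, ∀ t : ℝ, ‖iteratedFDeriv ℝ i Real.smoothTransition t‖ ≤ Cρ := by
  have hsm : ContDiff ℝ ∞ Real.smoothTransition := Real.smoothTransition.contDiff
  -- bound on the compact interval for each order
  have hK : ∀ i : ℕ, ∃ M : ℝ, ∀ t ∈ Icc (0 : ℝ) 1,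
      ‖iteratedFDeriv ℝ i Real.smoothTransition t‖ ≤ M :=
    fun i => isCompact_Icc.exists_bound_of_continuousOn
      ((hsm.continuous_iteratedFDeriv (mod_cast le_top)).continuousOn)
  choose M hM using hK
  -- off the interval the function is locally constant
  have hoff : ∀ (i : ℕ) (t : ℝ), t ∉ Icc (0 : ℝ) 1 →
      ‖iteratedFDeriv ℝ i Real.smoothTransition t‖ ≤ 1 := by
    intro i t ht
    rw [mem_Icc, not_and_or, not_le, not_le] at ht
    rcases ht with ht | ht
    · have hev : Real.smoothTransition =ᶠ[𝓝 t] fun _ => (0 : ℝ) := by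
        filter_upwards [Iio_mem_nhds ht] with s hs
        exact Real.smoothTransition.zero_of_nonpos (le_of_lt hs)
      rw [(hev.iteratedFDeriv ℝ i).eq_of_nhds]
      rcases Nat.eq_zero_or_pos i with rfl | hi0
      · simp
      · rw [iteratedFDeriv_const_of_ne hi0.ne', Pi.zero_apply, norm_zero]
        exact zero_le_one
    · have hev : Real.smoothTransition =ᶠ[𝓝 t] fun _ => (1 : ℝ) := by
        filter_upwards [Ioi_mem_nhds ht] with s hs
        exact Real.smoothTransition.one_of_one_le (le_of_lt hs)
      rw [(hev.iteratedFDeriv ℝ i).eq_of_nhds]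
      rcases Nat.eq_zero_or_pos i with rfl | hi0
      · simp
      · rw [iteratedFDeriv_const_of_ne hi0.ne', Pi.zero_apply, norm_zero]
        exact zero_le_one
  refine ⟨max 1 (max (M 0) (max (M 1) (M 2))), fun i hi t => ?_⟩
  by_cases ht : t ∈ Icc (0 : ℝ) 1
  · have h := hM i t ht
    rcases (by omega : i = 0 ∨ i = 1 ∨ i = 2) with rfl | rfl | rfl
    · exact h.trans (le_max_of_le_right (le_max_left _ _))
    · exact h.trans (le_max_of_le_right (le_max_of_le_right (le_max_left _ _)))
    · exact h.trans (le_max_of_le_right (le_max_of_le_right (le_max_right _ _)))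
  · exact (hoff i t ht).trans (le_max_left _ _)

/-- Composition of a real tame function with `Real.smoothTransition` is tame. [folklore] -/
theorem tame_smoothTransition (hU : IsOpen U) (hB : ∀ x ∈ U, 1 ≤ B x) {f : X → ℝ}
    (hf : ContDiffOn ℝ ∞ f U ∧ ∃ (C : ℝ) (k : ℕ), ∀ x ∈ U, ∀ i ≤ 2,
      ‖iteratedFDerivWithin ℝ i f U x‖ ≤ C * B x ^ k) :
    ContDiffOn ℝ ∞ (fun x => Real.smoothTransition (f x)) U ∧ ∃ (C : ℝ) (k : ℕ), ∀ x ∈ U,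
      ∀ i ≤ 2, ‖iteratedFDerivWithin ℝ i (fun x => Real.smoothTransition (f x)) U x‖ ≤
        C * B x ^ k := by
  obtain ⟨Cρ, hρ⟩ := exists_bound_iteratedFDeriv_two_smoothTransition
  refine tame_comp hU hB isOpen_univ (Real.smoothTransition.contDiff (n := ⊤)).contDiffOn
    (mapsTo_univ f U) (Cg := Cρ) (kg := 0) (fun x _ i hi => ?_) hf
  rw [iteratedFDerivWithin_univ, pow_zero, mul_one]
  exact hρ i hi (f x)

/-- From the tame bounds to the applied bounds on the first two derivatives at a point of the open
set `U`. [folklore] -/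
theorem tame_apply_bounds (hU : IsOpen U) {f : X → F} {C : ℝ} {k : ℕ} {x : X} (hx : x ∈ U)
    (hb : ∀ i ≤ 2, ‖iteratedFDerivWithin ℝ i f U x‖ ≤ C * B x ^ k) (v w : X) :
    ‖fderiv ℝ f x v‖ ≤ C * B x ^ k * ‖v‖ ∧
      ‖iteratedFDeriv ℝ 2 f x ![v, w]‖ ≤ C * B x ^ k * ‖v‖ * ‖w‖ := by
  have h1 := hb 1 (by norm_num)
  have h2 := hb 2 le_rfl
  rw [iteratedFDerivWithin_of_isOpen 1 hU hx] at h1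
  rw [iteratedFDerivWithin_of_isOpen 2 hU hx] at h2
  constructor
  · have e : fderiv ℝ f x v = iteratedFDeriv ℝ 1 f x ![v] := by
      rw [iteratedFDeriv_one_apply]; rfl
    rw [e]
    refine ((iteratedFDeriv ℝ 1 f x).le_opNorm _).trans ?_
    rw [Fin.prod_univ_one]
    exact mul_le_mul_of_nonneg_right h1 (norm_nonneg _)
  · refine ((iteratedFDeriv ℝ 2 f x).le_opNorm _).trans ?_
    rw [Fin.prod_univ_two, ← mul_assoc]
    refine mul_le_mul_of_nonneg_right (mul_le_mul_of_nonneg_right h2 (norm_nonneg _))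
      (norm_nonneg _)

end Literature.Analysis.Calculus
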